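import Summits.ValiantsHypothesis.ValiantsHypothesis.Theorems.LacunarySymmetroidMatrixDescartesPivotRankOneResolventPairForm
import Summits.ValiantsHypothesis.ValiantsHypothesis.Theorems.LacunarySymmetroidMatrixDescartesPivotRankOneResolventConfinement
import Summits.ValiantsHypothesis.ValiantsHypothesis.Theorems.LacunarySymmetroidMatrixDescartesCensusMobiusDescartes

/-!
# `MatrixDescartes` census — rank-one `(2,4)₁`, chamber (C): the BERNSTEIN CERTIFICATE THEOREM
# (`Z₊(det F) ≤ 1 + Var(Ψ_c(Φ))` for every `c` past the zero of the e-signed pair form — the chain assembled)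

HONEST FRAMING.  Object-search cell `pub-symmetroid`, seat `val-sym-mdr-p1` (generation 18); helper file `--supports` the crux item
stmt-ValiantsHypothesis-18050 (`Theses.LacunarySymmetroid.MatrixDescartes`, OPEN, on HOLD) with NO closure claim.  ASSEMBLY of this seat's
chain for the last open piece of «rank-one (2,4)₁ = 8» (chamber (C) of the `1|3` split): `Z₊(det F) ≤ 1 + Z₊(Φ)` (`…PivotRankOneResolventPairForm`,
from the resolvent Rolle bound `…PivotResolventRolle`), `Φ = W² + (τ² + 4δπ)·P_e` (pair-form identity, ibid.), `P_e > 0` propagates to the right on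
the `1|3` split when `d₀ + d₃ ≤ d₁ + d₂` (`…PivotRankOneResolventConfinement`), and Descartes' rule on `(0, c)` in Möbius/Bernstein form
(`…CensusMobiusDescartes`).  RESULT (`rankOne_four_card_posRoots_le_one_add_signVariations`): for the pencil `X^e J + ∑ wₖ X^{dₖ} vₖvₖᵀ` with
`J` symmetric, `det J < 0`, weights `≥ 0`, exponents `d₀ < e < d₁ ≤ d₂ ≤ d₃` with `d₀ + d₃ ≤ d₁ + d₂` (chamber (C) included), positive resolvent
discriminant on `(0, ∞)`, and ANY `c > 0` at which the e-signed pair form `P_e(c) = ∑_{k<l} (dₖ − e)(d_l − e) wₖw_l D_{kl}² c^{dₖ+d_l}` is positive: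
**`Z₊(det F) ≤ Var(Ψ_c) + 1`**, `Ψ_c = ∑_{k ≤ n} Φₖ cᵏ Xᵏ (1+X)^{n−k}` (`n ≥ deg Φ`).  So «(C) ≤ 8» follows from ONE sign-variation count
`Var(Ψ_c) ≤ 7` per configuration; located (seat memo RESOLVENT-PROFILE.md §3e, exact rationals, 360 chamber-(C) samples incl. clustered far-`t₀`
designs): `Var(Ψ_c) ≤ 5` at `c = x_P(1+10⁻⁴)` in every sample — the uniform count is CONJECTURE B, not proved.  Nothing here bears on
`MatrixDescartes` in its window, on `DoorA26` / `DoorA34`, registers / credences, or `VP ≠ VNP`; rank-one register `{8, 9}` unchanged.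

[folklore] Composition of the tree lemmas named above.  No definitions, no named facts.
-/

-- `Summit.ValiantsHypothesis.ValiantsHypothesis.…` repeats a component by the D-0017 layout
-- (single-conjunct summit), which the `dupNamespace` linter flags; the name is mandated.
set_option linter.dupNamespace false

namespace Summit.ValiantsHypothesis.ValiantsHypothesis.Theorems.LacunarySymmetroidMatrixDescartes.Pivot.Resolvent

open Polynomial Matrix Finset Set
open scoped BigOperators

/-- **BERNSTEIN CERTIFICATE THEOREM for chamber (C).**  See the module docstring: `Z₊(det F) ≤ Var(Ψ_c(Φ)) + 1` for every `c > 0` with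
`P_e(c) > 0`, on the `1|3` split with `d₀ + d₃ ≤ d₁ + d₂`. [this file, assembling `…ResolventRolle` / `…PairForm` / `…Confinement` / `…MobiusDescartes`] -/
theorem rankOne_four_card_posRoots_le_one_add_signVariations (e d₀ d₁ d₂ d₃ : ℕ) (h0e : d₀ < e) (he1 : e < d₁) (h12 : d₁ ≤ d₂)
    (h23 : d₂ ≤ d₃) (hC : d₀ + d₃ ≤ d₁ + d₂) (J : Matrix (Fin 2) (Fin 2) ℝ) (hJ : J 1 0 = J 0 1) (hdJ : J 0 0 * J 1 1 - J 0 1 ^ 2 < 0)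
    (v₀ v₁ v₂ v₃ : Fin 2 → ℝ) (w₀ w₁ w₂ w₃ : ℝ) (hw₀ : 0 ≤ w₀) (hw₁ : 0 ≤ w₁) (hw₂ : 0 ≤ w₂) (hw₃ : 0 ≤ w₃)
    (𝔄 𝔘 ℭ τ π Φ : ℝ[X])
    (h𝔄 : 𝔄 = Polynomial.C (w₀ * v₀ 0 ^ 2) * X ^ d₀ + Polynomial.C (w₁ * v₁ 0 ^ 2) * X ^ d₁ + Polynomial.C (w₂ * v₂ 0 ^ 2) * X ^ d₂
      + Polynomial.C (w₃ * v₃ 0 ^ 2) * X ^ d₃)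
    (h𝔘 : 𝔘 = Polynomial.C (w₀ * (v₀ 0 * v₀ 1)) * X ^ d₀ + Polynomial.C (w₁ * (v₁ 0 * v₁ 1)) * X ^ d₁
      + Polynomial.C (w₂ * (v₂ 0 * v₂ 1)) * X ^ d₂ + Polynomial.C (w₃ * (v₃ 0 * v₃ 1)) * X ^ d₃)
    (hℭ : ℭ = Polynomial.C (w₀ * v₀ 1 ^ 2) * X ^ d₀ + Polynomial.C (w₁ * v₁ 1 ^ 2) * X ^ d₁ + Polynomial.C (w₂ * v₂ 1 ^ 2) * X ^ d₂
      + Polynomial.C (w₃ * v₃ 1 ^ 2) * X ^ d₃)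
    (hτ : τ = Polynomial.C (J 0 0) * ℭ - Polynomial.C (2 * J 0 1) * 𝔘 + Polynomial.C (J 1 1) * 𝔄)
    (hπ : π = 𝔄 * ℭ - 𝔘 ^ 2)
    (hΦ : Φ = Polynomial.C (J 0 1 ^ 2 - J 0 0 * J 1 1) * (X * π.derivative - Polynomial.C (2 * (e : ℝ)) * π) ^ 2
        + τ * (X * τ.derivative - Polynomial.C (e : ℝ) * τ) * (X * π.derivative - Polynomial.C (2 * (e : ℝ)) * π)
        - π * (X * τ.derivative - Polynomial.C (e : ℝ) * τ) ^ 2)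
    (hdisc : ∀ x, 0 < x → 0 < (τ.eval x) ^ 2 + 4 * (J 0 1 ^ 2 - J 0 0 * J 1 1) * π.eval x)
    (c : ℝ) (hc : 0 < c) (hPc : 0 < (((d₀ : ℝ) - e) * ((d₁ : ℝ) - e) * w₀ * w₁ * (v₀ 0 * v₁ 1 - v₀ 1 * v₁ 0) ^ 2 * c ^ (d₀ + d₁)
      + ((d₀ : ℝ) - e) * ((d₂ : ℝ) - e) * w₀ * w₂ * (v₀ 0 * v₂ 1 - v₀ 1 * v₂ 0) ^ 2 * c ^ (d₀ + d₂)
      + ((d₀ : ℝ) - e) * ((d₃ : ℝ) - e) * w₀ * w₃ * (v₀ 0 * v₃ 1 - v₀ 1 * v₃ 0) ^ 2 * c ^ (d₀ + d₃)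
      + ((d₁ : ℝ) - e) * ((d₂ : ℝ) - e) * w₁ * w₂ * (v₁ 0 * v₂ 1 - v₁ 1 * v₂ 0) ^ 2 * c ^ (d₁ + d₂)
      + ((d₁ : ℝ) - e) * ((d₃ : ℝ) - e) * w₁ * w₃ * (v₁ 0 * v₃ 1 - v₁ 1 * v₃ 0) ^ 2 * c ^ (d₁ + d₃)
      + ((d₂ : ℝ) - e) * ((d₃ : ℝ) - e) * w₂ * w₃ * (v₂ 0 * v₃ 1 - v₂ 1 * v₃ 0) ^ 2 * c ^ (d₂ + d₃)))
    (n : ℕ) (hn : Φ.natDegree ≤ n) :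
    ((Matrix.det (((X : ℝ[X]) ^ e) • J.map Polynomial.C
        + (Polynomial.C w₀ * X ^ d₀) • (vecMulVec v₀ v₀).map Polynomial.C
        + (Polynomial.C w₁ * X ^ d₁) • (vecMulVec v₁ v₁).map Polynomial.C
        + (Polynomial.C w₂ * X ^ d₂) • (vecMulVec v₂ v₂).map Polynomial.C
        + (Polynomial.C w₃ * X ^ d₃) • (vecMulVec v₃ v₃).map Polynomial.C)).roots.toFinset.filter (fun t => 0 < t)).card
      ≤ (∑ k ∈ Finset.range (n + 1), Polynomial.C (Φ.coeff k * c ^ k) * X ^ k * (1 + X) ^ (n - k)).signVariations + 1 := by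
  -- `Φ > 0` on `[c, ∞)`: pair-form identity + confinement + positive discriminant
  have hΦpos : ∀ x, c ≤ x → 0 < Φ.eval x := by
    intro x hcx
    have hx : 0 < x := lt_of_lt_of_le hc hcx
    have hP := pairForm_pos_of_le e d₀ d₁ d₂ d₃ h0e he1 h12 h23 hC v₀ v₁ v₂ v₃ w₀ w₁ w₂ w₃ hw₀ hw₁ hw₂ hw₃ c x hc hcx hPc
    rw [eval_criticalPoly_eq_sq_add e d₀ d₁ d₂ d₃ J v₀ v₁ v₂ v₃ w₀ w₁ w₂ w₃ 𝔄 𝔘 ℭ τ π Φ h𝔄 h𝔘 hℭ hτ hπ hΦ x]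
    have hS := hdisc x hx
    set Wx := (J 0 0 * ((((d₀ : ℝ) - e) * w₀ * x ^ d₀ * (v₀ 0 * v₀ 1) + ((d₁ : ℝ) - e) * w₁ * x ^ d₁ * (v₁ 0 * v₁ 1)
                    + ((d₂ : ℝ) - e) * w₂ * x ^ d₂ * (v₂ 0 * v₂ 1) + ((d₃ : ℝ) - e) * w₃ * x ^ d₃ * (v₃ 0 * v₃ 1))
                  * (w₀ * x ^ d₀ * v₀ 1 ^ 2 + w₁ * x ^ d₁ * v₁ 1 ^ 2 + w₂ * x ^ d₂ * v₂ 1 ^ 2 + w₃ * x ^ d₃ * v₃ 1 ^ 2)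
                - (w₀ * x ^ d₀ * (v₀ 0 * v₀ 1) + w₁ * x ^ d₁ * (v₁ 0 * v₁ 1) + w₂ * x ^ d₂ * (v₂ 0 * v₂ 1) + w₃ * x ^ d₃ * (v₃ 0 * v₃ 1))
                  * (((d₀ : ℝ) - e) * w₀ * x ^ d₀ * v₀ 1 ^ 2 + ((d₁ : ℝ) - e) * w₁ * x ^ d₁ * v₁ 1 ^ 2
                    + ((d₂ : ℝ) - e) * w₂ * x ^ d₂ * v₂ 1 ^ 2 + ((d₃ : ℝ) - e) * w₃ * x ^ d₃ * v₃ 1 ^ 2))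
          - J 0 1 * ((((d₀ : ℝ) - e) * w₀ * x ^ d₀ * v₀ 0 ^ 2 + ((d₁ : ℝ) - e) * w₁ * x ^ d₁ * v₁ 0 ^ 2
                    + ((d₂ : ℝ) - e) * w₂ * x ^ d₂ * v₂ 0 ^ 2 + ((d₃ : ℝ) - e) * w₃ * x ^ d₃ * v₃ 0 ^ 2)
                  * (w₀ * x ^ d₀ * v₀ 1 ^ 2 + w₁ * x ^ d₁ * v₁ 1 ^ 2 + w₂ * x ^ d₂ * v₂ 1 ^ 2 + w₃ * x ^ d₃ * v₃ 1 ^ 2)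
                - (w₀ * x ^ d₀ * v₀ 0 ^ 2 + w₁ * x ^ d₁ * v₁ 0 ^ 2 + w₂ * x ^ d₂ * v₂ 0 ^ 2 + w₃ * x ^ d₃ * v₃ 0 ^ 2)
                  * (((d₀ : ℝ) - e) * w₀ * x ^ d₀ * v₀ 1 ^ 2 + ((d₁ : ℝ) - e) * w₁ * x ^ d₁ * v₁ 1 ^ 2
                    + ((d₂ : ℝ) - e) * w₂ * x ^ d₂ * v₂ 1 ^ 2 + ((d₃ : ℝ) - e) * w₃ * x ^ d₃ * v₃ 1 ^ 2))
          + J 1 1 * ((((d₀ : ℝ) - e) * w₀ * x ^ d₀ * v₀ 0 ^ 2 + ((d₁ : ℝ) - e) * w₁ * x ^ d₁ * v₁ 0 ^ 2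
                    + ((d₂ : ℝ) - e) * w₂ * x ^ d₂ * v₂ 0 ^ 2 + ((d₃ : ℝ) - e) * w₃ * x ^ d₃ * v₃ 0 ^ 2)
                  * (w₀ * x ^ d₀ * (v₀ 0 * v₀ 1) + w₁ * x ^ d₁ * (v₁ 0 * v₁ 1) + w₂ * x ^ d₂ * (v₂ 0 * v₂ 1) + w₃ * x ^ d₃ * (v₃ 0 * v₃ 1))
                - (w₀ * x ^ d₀ * v₀ 0 ^ 2 + w₁ * x ^ d₁ * v₁ 0 ^ 2 + w₂ * x ^ d₂ * v₂ 0 ^ 2 + w₃ * x ^ d₃ * v₃ 0 ^ 2)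
                  * (((d₀ : ℝ) - e) * w₀ * x ^ d₀ * (v₀ 0 * v₀ 1) + ((d₁ : ℝ) - e) * w₁ * x ^ d₁ * (v₁ 0 * v₁ 1)
                    + ((d₂ : ℝ) - e) * w₂ * x ^ d₂ * (v₂ 0 * v₂ 1) + ((d₃ : ℝ) - e) * w₃ * x ^ d₃ * (v₃ 0 * v₃ 1)))) with hWx
    have h3 := mul_pos hS hP
    have h4 := sq_nonneg Wx
    linarith
  have hΦ0 : Φ ≠ 0 := by
    intro h; have := hΦpos c le_rfl; rw [h, eval_zero] at this; exact lt_irrefl _ this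
  have h1 := rankOne_four_card_posRoots_le_one_add e d₀ d₁ d₂ d₃ J hJ hdJ v₀ v₁ v₂ v₃ w₀ w₁ w₂ w₃ hw₀ hw₁ hw₂ hw₃ 𝔄 𝔘 ℭ τ π Φ h𝔄 h𝔘 hℭ
    hτ hπ hΦ hdisc hΦ0
  have h2 := card_posRoots_le_signVariations_mobius_of_pos Φ c hc n hn hΦpos
  omega

end Summit.ValiantsHypothesis.ValiantsHypothesis.Theorems.LacunarySymmetroidMatrixDescartes.Pivot.Resolvent
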